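import Mathlib
import Summits.ValiantsHypothesis.ValiantsHypothesis.Theorems.FifoMatchingNNDivisionHardZonotopeCofactors
import HarnessLib

/-!
# ★★★ PRODUCTS OF POLYNOMIALLY MANY SEGMENT-SUPPORTED FACTORS (binomials, univariate polynomials, `p(x^v)`, their powers) ARE NOT
# CERTIFICATES — the member theorem of the zonotope tier (crux `Theses.FifoMatching.NNDivisionHard`, stmt-ValiantsHypothesis-21181)

WHAT IS NEW.  ✓ `…ZonotopeCofactors.nnDivisionHard_zonotope` decides every cofactor whose Newton polytope is a zonotope with `≤ n^k` zones.
This file supplies the structural reading that makes the class concrete: the Newton polytope of a PRODUCT is the Minkowski SUM of the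
factors' Newton polytopes (✓ `newtonPolytope_mul`, Ostrowski), and a Minkowski sum of SEGMENTS is a zonotope — so

* `newtonPolytope_prod` — `Newt(Π_{i} p_i) = Σ_i Newt(p_i)` (Finset form of ✓ `newtonPolytope_mul`);
* `sum_pair_eq_range_subsetSum` — `Σ_i conv{u_i, u_i + v_i} = conv{Σ_i u_i + Σ_{i∈S} v_i : S ⊆ [M]}`;
* ★★★ `nnDivisionHard_prod_segments` — for all `c k`, eventually in `n`: every product `hh = Π_{i<M} p_i ≠ 0` over `ℝ≥0` of `M ≤ n^k`
  factors whose Newton polytopes are SEGMENTS `conv{u_i, u_i + v_i}` (binomials `a x^α + b x^β` and their powers, univariate polynomials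
  `p_i(x_e)` in one arc variable, polynomials `p_i(x^v)` in one monomial, monomials (`v_i = 0`)) satisfies the crux's literal inequality
  `2^((log₂ n + c)^c) < L₊(NN_n · hh) + L₊(hh)` — any degrees, any directions `v_i`, up to `n^k` factors (e.g. `Π_e (1 + x_e)^{D_e}` over
  all `4n²` arcs: `2^{4n²}` vertices, Newton dimension `4n²`; the census's named zonotope-like survivor class).

HONEST FRAMING: a restriction theorem (a decided sub-class of cofactors), NOT the crux: stmt-21181 `NNDivisionHard` OPEN (survivors: cheap
cofactors whose Newton polytope is neither low-dimensional, nor few-generated, nor on few parallel flats, nor a zonotope with `n^{O(1)}` zones —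
e.g. products of many TRIANGLE-supported factors); COR-VIRTUAL OPEN; `NNNotVP` OPEN; `VP ≠ VNP` NOT proved.  No definitions, no named
facts, no sorry.  References: Hrubeš–Yehudayoff 2021 §6 Problem 2 [HrubesYehudayoff2021]; Blekherman–Parrilo–Thomas 2012 (3.21)
[BlekhermanParriloThomas2012].
-/

set_option autoImplicit false

-- the mandated summit-side namespace repeats a component by design (single-problem summit)
set_option linter.dupNamespace false

noncomputable section

open Matrix Finset
open scoped Pointwise

namespace Summit.ValiantsHypothesis.ValiantsHypothesis.Theorems.FifoMatching

namespace Zono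

open MvPolynomial
open scoped NNReal
open Literature.Computability.AlgebraicComplexity (complexity nestFreeMatchingPoly)
open Literature.Algebra.Polynomial.NewtonPolytope (newtonPolytope newtonPolytope_mul newtonPolytope_one)

/-! ## §1 Newton polytopes of products; Minkowski sums of segments -/

/-- `Newt(Π_{i∈s} p_i) = Σ_{i∈s} Newt(p_i)`. [cite: BlekhermanParriloThomas2012, Ch. 3 §3.3.4 (3.21)] -/
theorem newtonPolytope_prod {σ ι : Type} (s : Finset ι) (p : ι → MvPolynomial σ ℝ) :
    newtonPolytope (∏ i ∈ s, p i) = ∑ i ∈ s, newtonPolytope (p i) := by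
  classical
  induction s using Finset.induction_on with
  | empty =>
    rw [Finset.prod_empty, Finset.sum_empty, newtonPolytope_one]
    rfl
  | insert i s hi ih =>
    rw [Finset.prod_insert hi, Finset.sum_insert hi, newtonPolytope_mul, ih]

/-- a Minkowski sum of segments is a zonotope: `Σ_i conv{u_i, u_i + v_i} = conv{Σ_i u_i + Σ_{i∈S} v_i : S ⊆ [M]}`. [folklore] -/
theorem sum_pair_eq_range_subsetSum {E : Type} [AddCommGroup E] [Module ℝ E] {M : ℕ} (u v : Fin M → E) :
    ∑ i, convexHull ℝ ({u i, u i + v i} : Set E) =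
      convexHull ℝ (Set.range fun S : Finset (Fin M) => (∑ i, u i) + ∑ i ∈ S, v i) := by
  classical
  rw [← convexHull_sum]
  congr 1
  ext a
  rw [Set.mem_fintype_sum]
  constructor
  · rintro ⟨g, hg, rfl⟩
    refine ⟨Finset.univ.filter fun i => g i ≠ u i, ?_⟩
    have hgi : ∀ i, g i = u i + (if g i ≠ u i then v i else 0) := by
      intro i
      have hmem := hg i
      simp only [Set.mem_insert_iff, Set.mem_singleton_iff] at hmem
      by_cases hne : g i = u i
      · simp [hne]
      · rcases hmem with h | h
        · exact absurd h hne
        · simp [h]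
    calc (∑ i, u i) + ∑ i ∈ Finset.univ.filter (fun i => g i ≠ u i), v i
        = ∑ i, (u i + if g i ≠ u i then v i else 0) := by
          rw [Finset.sum_add_distrib, Finset.sum_filter]
      _ = ∑ i, g i := Finset.sum_congr rfl fun i _ => (hgi i).symm
  · rintro ⟨S, rfl⟩
    refine ⟨fun i => if i ∈ S then u i + v i else u i, fun i => ?_, ?_⟩
    · by_cases h : i ∈ S <;> simp [h]
    · have : ∀ i, (if i ∈ S then u i + v i else u i) = u i + if i ∈ S then v i else 0 := by
        intro i; by_cases h : i ∈ S <;> simp [h]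
      simp_rw [this]
      rw [Finset.sum_add_distrib, ← Finset.sum_filter, Finset.filter_mem_eq_inter, Finset.univ_inter]

/-! ## §2 The member theorem -/

/-- ★★★ **PRODUCTS OF POLYNOMIALLY MANY SEGMENT-SUPPORTED FACTORS ARE NOT CERTIFICATES (PROVED, unconditional):** for all `c k`,
eventually in `n`, every product `Π_{i<M} p_i ≠ 0` over `ℝ≥0` with `M ≤ n^k` factors whose Newton polytopes are segments
`conv{u_i, u_i + v_i}` (binomials and their powers, univariate polynomials in one arc, polynomials in one monomial `x^v`, monomials)
satisfies `2^((log₂ n + c)^c) < L₊(NN_n · Π p_i) + L₊(Π p_i)` — any degrees, any directions, up to `n^k` factors.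
[cite: HrubesYehudayoff2021, §6 Problem 2] [cite: BlekhermanParriloThomas2012, Ch. 3 §3.3.4 (3.21)] -/
theorem nnDivisionHard_prod_segments (c k : ℕ) : ∃ n₀ : ℕ, ∀ n ≥ n₀, ∀ (M : ℕ), M ≤ n ^ k →
    ∀ (p : Fin M → MvPolynomial (Fin (2 * n) × Fin (2 * n)) ℝ≥0)
      (u v : Fin M → (Fin (2 * n) × Fin (2 * n)) → ℝ),
      (∀ i, newtonPolytope (MvPolynomial.map NNReal.toRealHom (p i)) = convexHull ℝ {u i, u i + v i}) →
      ∏ i, p i ≠ 0 →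
        2 ^ ((Nat.log 2 n + c) ^ c) <
          complexity (nestFreeMatchingPoly n ℝ≥0 * ∏ i, p i) + complexity (∏ i, p i) := by
  obtain ⟨n₀, hn₀⟩ := nnDivisionHard_zonotope c k
  refine ⟨n₀, fun n hn M hM p u v hNewt hne => ?_⟩
  refine hn₀ n hn (∏ i, p i) hne v (∑ i, u i) ?_ hM
  rw [map_prod, newtonPolytope_prod, ← sum_pair_eq_range_subsetSum]
  exact Finset.sum_congr rfl fun i _ => hNewt i

end Zono

end Summit.ValiantsHypothesis.ValiantsHypothesis.Theorems.FifoMatching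

end
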